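import Summits.CriticalPhenomena.PercolationContinuityZ3.Theorems.PercNearOneGluingNoHeavyLowerTailSahiCTCRtThreeHighRows
import Summits.CriticalPhenomena.PercolationContinuityZ3.Theorems.PercNearOneGluingNoHeavyLowerTailSahiCTCRtThreeLoopPeel
import HarnessLib

/-!
# `NoHeavyLowerTail` (crux stmt-CriticalPhenomena-4575), P3 lane: THE PEEL INDUCTION — `R_3 ∈ ℕ[s]` for all pairs of up-sets follows from
# three local statements: the adjacent peels (doubled / single neighbour, "either side" form), the isolated drop, and the diagonal base

Support file (seat `prim-l12-p3`, gen 44; `--supports stmt-CriticalPhenomena-4575`).  Memo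
`run/shared/lean/prim/prim-l12/FROM-prim-l12-p3-g44-R3-PEELS.md` §4.

This is the `R_3`-level replacement of g43's conditional reduction `…C2ThreeReduction.coeff_Rt_three_nonneg_of_lowRows`.  With
`T(n) = coeff_n R_3(𝒳,𝒵)` and a single point `s` of `n` (`n_s = 1`), write `𝒳^s = 𝒳 ∪ {S : s ∈ S}` (an up-set, `isUpperSet_union_filter_mem`).  The tree already has:
the loop peel (`…RtThreeLoopPeel`), the unconditional high rows and the drop at `≥ 3` doubled points (`…RtThreeHighRows`).  **`coeff_Rt_three_nonneg_of_peels`**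
performs the induction on the number of single points of the profile (memo §4) and isolates exactly what is still to be proved, as four hypotheses
(stated inline, quantified over ALL pairs of up-sets on the ground type):
* (A*) — at a loop-free single point `s` with a common edge `{s,d}` to a DOUBLED point, profile entries `≤ 2`, `≤ 2` doubled points:
  `T[𝒳^s,𝒵](n+e_s) + T(n−e_s) ≤ T(n)` OR the same with the loop added to `𝒵` (memo §3: conjecture (A*); the one-sided versions are false);
* (A″) — the same at a common edge `{s,t}` with `t` single, when no single point is a loop or has a common edge to a doubled point (memo §3.5);
* (I) — if no single point is a loop or has a common edge inside the support, `T(n−e_s) ≤ T(n)` (memo §5, provable from the κ-expansion);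
* (base) — `T(n) ≥ 0` for profiles with entries in `{0,2}` and at most three doubled points (≤ 3 points; memo §1, inclusion–exclusion).
Nothing is asserted about the crux; the four hypotheses are NOT proved here.
-/

noncomputable section

open scoped Classical

namespace Summit.CriticalPhenomena.PercolationContinuityZ3.Theorems.SahiCTCForms

open Finset MvPolynomial SahiCTCGenFun

variable {α : Type*} [DecidableEq α] [Fintype α]

/-! ### Adding a loop; the number of single points -/

/-- Adding the loop `{s}` (all sets containing `s`) to an up-set gives an up-set. [this work] -/
theorem isUpperSet_union_filter_mem {F : Finset (Finset α)} (hF : IsUpperSet (F : Set (Finset α))) (s : α) :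
    IsUpperSet (((F ∪ univ.filter fun S => s ∈ S : Finset (Finset α))) : Set (Finset α)) := by
  intro a b hab ha
  rw [Finset.mem_coe, mem_union, mem_filter] at ha ⊢
  rcases ha with ha | ⟨-, ha⟩
  · exact Or.inl (hF hab ha)
  · exact Or.inr ⟨mem_univ _, hab ha⟩

omit [Fintype α] in
/-- Doubling a single point removes it from the single points. [this work] -/
theorem ones_add_single {n : α →₀ ℕ} {s : α} (hs : n s = 1) :
    #((n + Finsupp.single s 1).support.filter fun i => (n + Finsupp.single s 1 : α →₀ ℕ) i = 1) + 1 = #(n.support.filter fun i => n i = 1) := by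
  have hmem : s ∈ n.support.filter fun i => n i = 1 := mem_filter.2 ⟨Finsupp.mem_support_iff.2 (by omega), hs⟩
  set m : α →₀ ℕ := n + Finsupp.single s 1 with hm
  have : m.support.filter (fun i => m i = 1) = (n.support.filter fun i => n i = 1).erase s := by
    ext i
    simp only [hm, mem_filter, Finsupp.mem_support_iff, Finsupp.add_apply, Finsupp.single_apply, mem_erase]
    by_cases h : s = i
    · subst h; simp [hs]
    · simp only [h, if_false, add_zero]; exact ⟨fun ⟨h1, h2⟩ => ⟨fun h' => h h'.symm, h1, h2⟩, fun ⟨_, h1, h2⟩ => ⟨h1, h2⟩⟩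
  rw [this, card_erase_add_one hmem]

omit [Fintype α] in
/-- Removing a single point removes it from the single points. [this work] -/
theorem ones_tsub_single {n : α →₀ ℕ} {s : α} (hs : n s = 1) :
    #((n - Finsupp.single s 1).support.filter fun i => (n - Finsupp.single s 1 : α →₀ ℕ) i = 1) + 1 = #(n.support.filter fun i => n i = 1) := by
  have hmem : s ∈ n.support.filter fun i => n i = 1 := mem_filter.2 ⟨Finsupp.mem_support_iff.2 (by omega), hs⟩
  set m : α →₀ ℕ := n - Finsupp.single s 1 with hm
  have : m.support.filter (fun i => m i = 1) = (n.support.filter fun i => n i = 1).erase s := by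
    ext i
    simp only [hm, mem_filter, Finsupp.mem_support_iff, Finsupp.tsub_apply, Finsupp.single_apply, mem_erase]
    by_cases h : s = i
    · subst h; simp [hs]
    · simp only [h, if_false, tsub_zero]; exact ⟨fun ⟨h1, h2⟩ => ⟨fun h' => h h'.symm, h1, h2⟩, fun ⟨_, h1, h2⟩ => ⟨h1, h2⟩⟩
  rw [this, card_erase_add_one hmem]

omit [DecidableEq α] [Fintype α] in
/-- A profile without single points and with entries `≤ 2` has entries in `{0, 2}`. [this work] -/
theorem eq_zero_or_two_of_ones_eq_zero {n : α →₀ ℕ} (h2 : ∀ i, n i ≤ 2) (h0 : #(n.support.filter fun i => n i = 1) = 0) (i : α) :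
    n i = 0 ∨ n i = 2 := by
  have hi : i ∉ n.support.filter fun i => n i = 1 := by rw [card_eq_zero.1 h0]; exact notMem_empty i
  rw [mem_filter, Finsupp.mem_support_iff, not_and] at hi
  have := h2 i
  by_cases hz : n i = 0
  · exact Or.inl hz
  · have := hi hz; omega

omit [DecidableEq α] [Fintype α] in
/-- A profile with a single point. [this work] -/
theorem exists_single_of_ones_ne_zero {n : α →₀ ℕ} (h : #(n.support.filter fun i => n i = 1) ≠ 0) : ∃ s, n s = 1 := by
  obtain ⟨s, hs⟩ := card_pos.1 (Nat.pos_of_ne_zero h)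
  exact ⟨s, (mem_filter.1 hs).2⟩

/-! ### The induction -/

/-- **THE PEEL INDUCTION.**  If the adjacent peels (doubled and single neighbour, either-side form), the isolated drop and the diagonal base hold
for all pairs of up-sets on `α`, then `R_3(𝒳,𝒵) ∈ ℕ[s]` for every pair of up-sets `𝒳, 𝒵` on `α` (memo g44 §4: induction on the number of single
points; entries `≥ 3`, `≥ 4` doubled points and the drop at `3` doubled points are tree theorems, loops peel by `…RtThreeLoopPeel`). [this work] -/
theorem coeff_Rt_three_nonneg_of_peels
    -- (A*) adjacent peel at a doubled neighbour, either-side form (memo §3)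
    (hA : ∀ (F G : Finset (Finset α)), IsUpperSet (F : Set (Finset α)) → IsUpperSet (G : Set (Finset α)) →
      ∀ (n : α →₀ ℕ) (s d : α), n s = 1 → n d = 2 → ({s, d} : Finset α) ∈ F → ({s, d} : Finset α) ∈ G →
        ({s} : Finset α) ∉ F → ({s} : Finset α) ∉ G → (∀ i, n i ≤ 2) → #(dbl n) ≤ 2 →
        (Rt 3 (F ∪ univ.filter fun S => s ∈ S) G).coeff (n + Finsupp.single s 1) + (Rt 3 F G).coeff (n - Finsupp.single s 1) ≤ (Rt 3 F G).coeff n ∨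
        (Rt 3 F (G ∪ univ.filter fun S => s ∈ S)).coeff (n + Finsupp.single s 1) + (Rt 3 F G).coeff (n - Finsupp.single s 1) ≤ (Rt 3 F G).coeff n)
    -- (A″) adjacent peel at a single neighbour, either-side form, in the regime without single loops / single–doubled common edges (memo §3.5)
    (hA2 : ∀ (F G : Finset (Finset α)), IsUpperSet (F : Set (Finset α)) → IsUpperSet (G : Set (Finset α)) →
      ∀ (n : α →₀ ℕ) (s t : α), s ≠ t → n s = 1 → n t = 1 → ({s, t} : Finset α) ∈ F → ({s, t} : Finset α) ∈ G →
        (∀ u, n u = 1 → ({u} : Finset α) ∉ F ∧ ({u} : Finset α) ∉ G) →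
        (∀ u d, n u = 1 → n d = 2 → ¬ (({u, d} : Finset α) ∈ F ∧ ({u, d} : Finset α) ∈ G)) →
        (∀ i, n i ≤ 2) → #(dbl n) ≤ 2 →
        (Rt 3 (F ∪ univ.filter fun S => s ∈ S) G).coeff (n + Finsupp.single s 1) + (Rt 3 F G).coeff (n - Finsupp.single s 1) ≤ (Rt 3 F G).coeff n ∨
        (Rt 3 F (G ∪ univ.filter fun S => s ∈ S)).coeff (n + Finsupp.single s 1) + (Rt 3 F G).coeff (n - Finsupp.single s 1) ≤ (Rt 3 F G).coeff n)
    -- (I) isolated drop (memo §5)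
    (hI : ∀ (F G : Finset (Finset α)), IsUpperSet (F : Set (Finset α)) → IsUpperSet (G : Set (Finset α)) →
      ∀ (n : α →₀ ℕ) (s : α), n s = 1 → (∀ i, n i ≤ 2) → #(dbl n) ≤ 2 →
        (∀ u, n u = 1 → ({u} : Finset α) ∉ F ∧ ({u} : Finset α) ∉ G ∧
          ∀ w, w ≠ u → n w ≠ 0 → ¬ (({u, w} : Finset α) ∈ F ∧ ({u, w} : Finset α) ∈ G)) →
        (Rt 3 F G).coeff (n - Finsupp.single s 1) ≤ (Rt 3 F G).coeff n)
    -- diagonal base: entries in {0,2}, at most three doubled points (memo §1)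
    (hB : ∀ (F G : Finset (Finset α)), IsUpperSet (F : Set (Finset α)) → IsUpperSet (G : Set (Finset α)) →
      ∀ (n : α →₀ ℕ), (∀ i, n i = 0 ∨ n i = 2) → #(dbl n) ≤ 3 → 0 ≤ (Rt 3 F G).coeff n)
    {F G : Finset (Finset α)} (hF : IsUpperSet (F : Set (Finset α))) (hG : IsUpperSet (G : Set (Finset α))) (n : α →₀ ℕ) :
    0 ≤ (Rt 3 F G).coeff n := by
  -- strong induction on the number of single points, for all pairs of up-sets simultaneously
  suffices key : ∀ k : ℕ, ∀ (F G : Finset (Finset α)), IsUpperSet (F : Set (Finset α)) → IsUpperSet (G : Set (Finset α)) →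
      ∀ n : α →₀ ℕ, #(n.support.filter fun i => n i = 1) = k → 0 ≤ (Rt 3 F G).coeff n from key _ F G hF hG n rfl
  intro k
  induction k using Nat.strong_induction_on with
  | _ k ih =>
  intro F G hF hG n hk
  -- an entry ≥ 3: unconditional
  by_cases h3 : ∃ w, 3 ≤ n w
  · obtain ⟨w, hw⟩ := h3; exact coeff_Rt_three_nonneg_of_three_le hF hG hw
  have h2 : ∀ i, n i ≤ 2 := fun i => by by_contra h; exact h3 ⟨i, by omega⟩
  -- four doubled points: unconditional
  by_cases h4 : 4 ≤ #(dbl n)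
  · exact coeff_Rt_three_nonneg_of_four_le_card_dbl hF hG h4
  -- no single point: the diagonal base
  by_cases h0 : #(n.support.filter fun i => n i = 1) = 0
  · exact hB F G hF hG n (eq_zero_or_two_of_ones_eq_zero h2 h0) (by omega)
  obtain ⟨s, hs⟩ := exists_single_of_ones_ne_zero h0
  -- the two induction instances at a single point `t`
  have ihDown : ∀ {t : α}, n t = 1 → ∀ (F' G' : Finset (Finset α)), IsUpperSet (F' : Set (Finset α)) → IsUpperSet (G' : Set (Finset α)) →
      0 ≤ (Rt 3 F' G').coeff (n - Finsupp.single t 1) := fun {t} ht F' G' hF' hG' =>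
    ih _ (by rw [← hk, ← ones_tsub_single ht]; omega) F' G' hF' hG' _ rfl
  have ihUp : ∀ {t : α}, n t = 1 → ∀ (F' G' : Finset (Finset α)), IsUpperSet (F' : Set (Finset α)) → IsUpperSet (G' : Set (Finset α)) →
      0 ≤ (Rt 3 F' G').coeff (n + Finsupp.single t 1) := fun {t} ht F' G' hF' hG' =>
    ih _ (by rw [← hk, ← ones_add_single ht]; omega) F' G' hF' hG' _ rfl
  -- three doubled points: drop `s`
  by_cases hd3 : 3 ≤ #(dbl n)
  · exact (ihDown hs F G hF hG).trans (coeff_Rt_three_drop_of_three_le_card_dbl hF hG hs hd3)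
  have hd2 : #(dbl n) ≤ 2 := by omega
  -- a single point that is a loop of either family: loop peel
  by_cases hloop : ∃ t, n t = 1 ∧ (({t} : Finset α) ∈ F ∨ ({t} : Finset α) ∈ G)
  · obtain ⟨t, ht, htl⟩ := hloop
    set m := n - Finsupp.single t 1 with hm
    have hmt : m t = 0 := by rw [hm, Finsupp.tsub_apply, Finsupp.single_eq_same, ht]
    have hn : n = m + Finsupp.single t 1 := by rw [hm, tsub_add_cancel_of_le]; rw [Finsupp.single_le_iff, ht]
    have hpeel : (Rt 3 F G).coeff (m + Finsupp.single t 2) + (Rt 3 F G).coeff m ≤ (Rt 3 F G).coeff (m + Finsupp.single t 1) := by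
      rcases htl with h | h
      · exact coeff_Rt_three_loopPeel hF hG h hmt
      · exact coeff_Rt_three_loopPeel' hF hG h hmt
    have hup : n + Finsupp.single t 1 = m + Finsupp.single t 2 := by rw [hn, add_assoc, ← Finsupp.single_add]
    have h1 := ihUp ht F G hF hG
    have h0' := ihDown ht F G hF hG
    rw [hup] at h1; rw [← hm] at h0'; rw [hn]
    linarith
  have hnoloop : ∀ u, n u = 1 → ({u} : Finset α) ∉ F ∧ ({u} : Finset α) ∉ G := fun u hu =>
    ⟨fun h => hloop ⟨u, hu, Or.inl h⟩, fun h => hloop ⟨u, hu, Or.inr h⟩⟩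
  -- a single point with a common edge to a doubled point: adjacent peel (doubled neighbour)
  by_cases hadjD : ∃ t d, n t = 1 ∧ n d = 2 ∧ ({t, d} : Finset α) ∈ F ∧ ({t, d} : Finset α) ∈ G
  · obtain ⟨t, d, ht, hd, htdF, htdG⟩ := hadjD
    rcases hA F G hF hG n t d ht hd htdF htdG (hnoloop t ht).1 (hnoloop t ht).2 h2 hd2 with h | h
    · have := ihUp ht (F ∪ univ.filter fun S => t ∈ S) G (isUpperSet_union_filter_mem hF t) hG; have := ihDown ht F G hF hG; linarith
    · have := ihUp ht F (G ∪ univ.filter fun S => t ∈ S) hF (isUpperSet_union_filter_mem hG t); have := ihDown ht F G hF hG; linarith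
  have hnoadjD : ∀ u d, n u = 1 → n d = 2 → ¬ (({u, d} : Finset α) ∈ F ∧ ({u, d} : Finset α) ∈ G) :=
    fun u d hu hd h => hadjD ⟨u, d, hu, hd, h.1, h.2⟩
  -- two single points with a common edge: adjacent peel (single neighbour)
  by_cases hadjS : ∃ t u, t ≠ u ∧ n t = 1 ∧ n u = 1 ∧ ({t, u} : Finset α) ∈ F ∧ ({t, u} : Finset α) ∈ G
  · obtain ⟨t, u, htu, ht, hu, hF', hG'⟩ := hadjS
    rcases hA2 F G hF hG n t u htu ht hu hF' hG' hnoloop hnoadjD h2 hd2 with h | h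
    · have := ihUp ht (F ∪ univ.filter fun S => t ∈ S) G (isUpperSet_union_filter_mem hF t) hG; have := ihDown ht F G hF hG; linarith
    · have := ihUp ht F (G ∪ univ.filter fun S => t ∈ S) hF (isUpperSet_union_filter_mem hG t); have := ihDown ht F G hF hG; linarith
  -- otherwise every single point is isolated and loop-free: drop `s`
  have hiso : ∀ u, n u = 1 → ({u} : Finset α) ∉ F ∧ ({u} : Finset α) ∉ G ∧
      ∀ w, w ≠ u → n w ≠ 0 → ¬ (({u, w} : Finset α) ∈ F ∧ ({u, w} : Finset α) ∈ G) := by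
    intro u hu
    refine ⟨(hnoloop u hu).1, (hnoloop u hu).2, fun w hwu hw h => ?_⟩
    have hw2 := h2 w
    by_cases hw1 : n w = 1
    · exact hadjS ⟨u, w, fun h' => hwu h'.symm, hu, hw1, h.1, h.2⟩
    · exact hnoadjD u w hu (by omega) h
  exact (ihDown hs F G hF hG).trans (hI F G hF hG n s hs h2 hd2 hiso)

end Summit.CriticalPhenomena.PercolationContinuityZ3.Theorems.SahiCTCForms
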